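import Literature.Barriers.CriticalPhenomena.RigorousRGSmallParameterRGStepGaussian
import Literature.Barriers.CriticalPhenomena.RigorousRGSmallParameterMapOneTransfer
import Literature.Barriers.CriticalPhenomena.RigorousRGSmallParameterRGRepresentation
import Literature.Barriers.CriticalPhenomena.RigorousRGSmallParameterPerturbativeRange
import HarnessLib

/-!
# `RigorousRGSmallParameter` (Slade, Theorem 1.4.1): Slade's renormalisation group map
# `(V, K) ↦ (U₊, K₊)` of §6.3 DEFINED, with its representation identity
# `𝔼₊θ(I ∘ K)(Λ) = e^{-δu₊|Λ|}(I₊ ∘ K₊)(Λ)`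

Companion ("proof architecture") file of
`Literature/Barriers/CriticalPhenomena/RigorousRGSmallParameter.lean`. Slade §6.3 (the map whose
estimates are Theorem 6.3.1, iterated in the named fact `Slade2017_prop822`): "The RG map
`U₊ : 𝔻 → 𝒰`, `K₊ : 𝔻 → 𝒦₊(Λ)`, is such that `(V,K) ∈ 𝔻_j` determine `U₊(V,K) = (δu₊, V₊)` and
`K₊ = K₊(V,K)`, with `I = I(V)` and `I₊ = I₊(V₊)`, with the property that
`𝔼₊θ(I ∘ K)(Λ) = e^{-δu₊|Λ|}(I₊ ∘ K₊)(Λ)`. The maps are defined in [BS-rg-step]. … The map `U₊` is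
given explicitly in [BS-rg-step] by `U₊(V,K) = Φ_pt(V̂)`, where `V̂ = V - Q(V,K)`,
`Q(V,K) = Σ_{Y ∈ 𝒮(Λ): Y ⊃ B} Loc_{Y,B} (K(Y)/I(V,Y))`."

This file assembles the concrete step data from the tree's vocabulary — `I_j(V,B)` (`Ifun`,
`…RGRepresentation`), `Loc_{Y,B}` and the Map-1 transfer `J` (`…MapOneTransfer`), `Φ_pt`
(`phiPtMap`, `…PerturbativeRange`), the leading part `h_ldg` of [BS-rg-IE]/[BS-rg-step] §5.2
((e:hptdefqq), via truncated expectations of `θV(B)`), `c = e^{-δu₊}` — into the `StepData` of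
`…RGStepAlgebra`, DEFINES **`kPlusSlade`** `= K₊(V,K)` (the composite Map 6 ∘ ⋯ ∘ Map 1 with
`𝔼₊ = 𝔼_{C_{j+1}}`), and PROVES **`expectF_theta_circ_eq_kPlusSlade`**, the displayed property, from
`…RGStepGaussian.expectF_theta_circ_eq_kPlus`; the remaining hypotheses are the regularity of the
data (`StepRegular`: field locality/measurability of `I(V), I(V̂), J` and of `K ∈ 𝒦_j`,
component factorisation of `K`), integrability of the Map-3 terms in the fluctuation field, and the
geometric conditions (`C_{j+1}` positive semidefinite of `ℓ^∞`-range `r`, `r + 2^{d+1}L^j ≤ L^{j+1}+1`,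
`L^j ∣ L^{j+1} ∣ L^N`).

Definitions: `StepParams`, `iBlock` (`I_j(V,·)` on blocks), `qFun` (`Q(V,K)(B)`), `qCoef` (its
coupling constants — "The fact that (Q-def) defines an element `Q ∈ 𝒬` is proved in Lemma
(lem:Qapp)" of [BS-rg-step] §13; here read off by choice, as `phiPtMap`), `vHat` (`V̂`), `uPlus`
(`U₊ = Φ_pt(V̂)`), `truncExpectF`, `hldg` (+ `hldg_support`), `sladeStepData` (+ `_c_mul_c'`,
`_Iplus'`: `I_pt⁺(B) = e^{-δu₊|B|}I₊(B)`, using that `W_{j+1}` does not see the constant coupling),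
`kPlusSlade`.

Not treated here: that `Q ∈ 𝒰` (Lemma (lem:Qapp)), the regularity `StepRegular` of the concrete
data, integrability, and every estimate of Theorem 6.3.1.

Sources: G. Slade, arXiv:1611.06169, §6.3; D. C. Brydges, G. Slade, arXiv:1403.7256, §1.8.2
((Q-def)), §3.1, §4.2–4.3, §5.1–5.3 ((e:hptdefqq)), §6.1–6.2, §13 (Lemma (lem:Qapp)).

## References

* [BrydgesSlade2015RGV] D. C. Brydges, G. Slade, *A renormalisation group method. V. A single
  renormalisation group step*, J. Stat. Phys. **159** (2015) 589–667, arXiv:1403.7256.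
* [Slade2017] G. Slade, *Critical exponents for long-range O(n) models below the upper critical
  dimension*, Commun. Math. Phys. **358** (2018) 343–436, arXiv:1611.06169.
-/

noncomputable section

namespace Literature.Barriers.CriticalPhenomena

namespace LongRangePhi4

namespace Polymer

open _root_.MeasureTheory Finset Literature.Probability.LatticeModels PTFun LocalPoly Loc

variable {d M n : ℕ} [NeZero M]

/-! ## The concrete step data of Slade's renormalisation group map -/

section StepDef

/-- The parameters of one renormalisation group step: block sides `b = L^j`, `b' = L^{j+1}`,
norm/localisation parameters `p_𝒩`, the field dimensions `[φ]_j`, `[φ]_{j+1}` and `d_+ = d`,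
truncation order `A` of `e^{ℒ}`, the accumulated covariances `w_j`, `w_{j+1} = w_j + C_{j+1}` and
the fluctuation covariance `C_{j+1}`. [cite: Slade2017, §4.3, §6.1, §6.3] -/
structure StepParams (d M : ℕ) where
  /-- `b = L^j` -/
  b : ℕ
  /-- `b' = L^{j+1}` -/
  b' : ℕ
  /-- `p_𝒩` -/
  pN : ℕ
  /-- `[φ]_j` -/
  dφ : ℝ
  /-- `[φ]_{j+1}` -/
  dφ' : ℝ
  /-- `d_+` -/
  dplus : ℝ
  /-- truncation order of `e^{ℒ_C}` -/
  A : ℕ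
  /-- `w_j = Σ_{i ≤ j} C_i` -/
  w : TorusSite d M → TorusSite d M → ℝ
  /-- `w_{j+1}` -/
  w' : TorusSite d M → TorusSite d M → ℝ
  /-- `C_{j+1}` -/
  C : TorusSite d M → TorusSite d M → ℝ

variable (P : StepParams d M)

/-- `I_j(V, B) = e^{-V(B)}(1 + W_j(V,B))` as a `j`-block activity, `V = gτ² + ντ + u`. [cite: Slade2017, §6.1 (display defining I_j(V,X))] -/
def iBlock (V : ℝ × ℝ × ℝ) : Finset (TorusSite d M) → (TorusSite d M → Fin n → ℝ) → ℝ :=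
  fun B => Ifun P.b P.pN P.dφ P.dplus P.w P.A V.1 V.2.1 V.2.2 B

/-- **`Q(V,K)(B) = Σ_{Y ∈ 𝒮(Λ) : Y ⊇ B} Loc_{Y,B} I(V)^{-Y} K(Y)`** as a function of the field
(Slade §6.3 display (Q); [BS-rg-step] (Q-def)). [cite: Slade2017, §6.3 (display defining V̂ = V − Q(V,K) and Q(V,K))] [cite: BrydgesSlade2015RGV, §1.8.2 ((Q-def))] -/
def qFun (V : ℝ × ℝ × ℝ) (K : Finset (TorusSite d M) → (TorusSite d M → Fin n → ℝ) → ℝ)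
    (B : Finset (TorusSite d M)) : (TorusSite d M → Fin n → ℝ) → ℝ :=
  locPiece P.b P.pN P.dφ P.dplus (iBlock P V) K B B +
    ∑ Y ∈ smallSupersets P.b B, locPiece P.b P.pN P.dφ P.dplus (iBlock P V) K Y B

open Classical in
/-- The coupling constants `(g_Q, ν_Q, u_Q)` of `Q(V,K)`, read off on the block of the origin:
`Q(B) = Σ_{x ∈ B}(g_Q τ_x² + ν_Q τ_x + u_Q)` ("The fact that (Q-def) defines an element `Q ∈ 𝒬` is
proved in Lemma (lem:Qapp)"; here by choice, `0` if no such representation exists).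
[cite: BrydgesSlade2015RGV, §1.8.2 (sentence after (Q-def)) and §13, Lemma (lem:Qapp)] -/
def qCoef (V : ℝ × ℝ × ℝ) (K : Finset (TorusSite d M) → (TorusSite d M → Fin n → ℝ) → ℝ) : ℝ × ℝ × ℝ :=
  if h : ∃ q : ℝ × ℝ × ℝ, qFun (n := n) P V K (block P.b 0) = localPolySum q.1 q.2.1 q.2.2 (block P.b 0)
  then h.choose else 0

/-- **`V̂ = V - Q(V,K)`** (as coupling constants). [cite: Slade2017, §6.3 (display V̂ = V − Q(V,K))] -/
def vHat (V : ℝ × ℝ × ℝ) (K : Finset (TorusSite d M) → (TorusSite d M → Fin n → ℝ) → ℝ) : ℝ × ℝ × ℝ :=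
  V - qCoef (n := n) P V K

/-- **`U₊(V,K) = Φ_pt(V̂) = (δu₊, V₊)`** with `Φ_pt = φ_pt^{(j)}` the perturbative map (`phiPtMap`,
Proposition 4.3 / (4.13)–(4.15) of [Slade2017]). [cite: Slade2017, §6.3 ("U₊(V,K) = Φ_pt(V̂)")] -/
def uPlus (V : ℝ × ℝ × ℝ) (K : Finset (TorusSite d M) → (TorusSite d M → Fin n → ℝ) → ℝ) : ℝ × ℝ × ℝ :=
  phiPtMap (n := n) P.pN P.dφ P.dplus P.C P.w P.A 0 (vHat (n := n) P V K)

/-- The truncated expectation `E_C(A;B) = E_C(AB) - (E_C A)(E_C B)` of the fluctuation field.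
[cite: BrydgesSlade2015RGV, §5.2 (display before (e:hptdefqq): "the truncated expectation")] -/
def truncExpectF (C : Matrix (TorusSite d M) (TorusSite d M) ℝ) (n : ℕ)
    (A B : (TorusSite d M → Fin n → ℝ) → (TorusSite d M → Fin n → ℝ) → ℝ) : (TorusSite d M → Fin n → ℝ) → ℝ :=
  expectF C n (A * B) - expectF C n A * expectF C n B

open Classical in
/-- **The leading part `h_ldg(U,B)`** ([BS-rg-IE] (e:hldg-def), no observables):
`h_ldg(U,B) = -½ 𝔼_{j+1}θ(V(B); V(Λ∖B))` if `U = B`, `= ½ 𝔼_{j+1}θ(V(B); V(U∖B))` if `U ⊃ B`,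
`|U|_{j+1} = 2` (and `U` small), `= 0` otherwise; at scale `j+1` (blocks of side `b'`), for the
couplings `V`. [cite: BrydgesSlade2015RGV, §5.2 ((e:hptdefqq): definition of h_ldg(U,B))] -/
def hldg (Cm : Matrix (TorusSite d M) (TorusSite d M) ℝ) (V : ℝ × ℝ × ℝ) (U B : Finset (TorusSite d M)) :
    (TorusSite d M → Fin n → ℝ) → ℝ :=
  if U = B ∧ (∃ x, B = block P.b' x) then
    -(2⁻¹ : ℝ) • truncExpectF Cm n (thetaF d M n (localPolySum V.1 V.2.1 V.2.2 B))
      (thetaF d M n (localPolySum V.1 V.2.1 V.2.2 (univ \ B)))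
  else if IsSmall P.b' U ∧ B ∈ blocksOf P.b' U ∧ numBlocks P.b' U = 2 then
    (2⁻¹ : ℝ) • truncExpectF Cm n (thetaF d M n (localPolySum V.1 V.2.1 V.2.2 B))
      (thetaF d M n (localPolySum V.1 V.2.1 V.2.2 (U \ B)))
  else 0

/-- `h_ldg` is supported on `𝒟_{j+1}`. [cite: BrydgesSlade2015RGV, §5.3 (proof of Lemma (lem:K5a): "Hypothesis (e:kprimecondition) is provided by (e:hpt0)")] -/
theorem hldg_support (Cm : Matrix (TorusSite d M) (TorusSite d M) ℝ) (V : ℝ × ℝ × ℝ) (U B : Finset (TorusSite d M))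
    (h : hldg (n := n) P Cm V U B ≠ 0) : IsSmall P.b' U ∧ B ∈ blocksOf P.b' U := by
  unfold hldg at h
  split_ifs at h with h1 h2
  · obtain ⟨rfl, x, rfl⟩ := h1
    exact ⟨isSmall_block P.b' x, mem_image_of_mem _ (mem_block_self P.b' x)⟩
  · exact ⟨h2.1, h2.2.1⟩
  · exact absurd rfl h

/-- **Slade's step data** `(I, Î, Ĩ_pt, I_pt⁺, I₊, J, h, c, c')` as functions of `(V, K)` and the
fluctuation covariance: `I = I_j(V)`, `Î = I_j(V̂)`, `Ĩ_pt(b) = Ĩ_{j+1}(V_pt, b)` with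
`V_pt = V₊ + δu₊`, `I₊(B) = I_{j+1}(V₊, B)`, `I_pt⁺(B) = e^{-δu₊|B|} I₊(B)`, `J` of Map 1 (`mapOneJ`),
`h = h_ldg` (with `V̂`), `c = e^{-δu₊}`, `c' = e^{δu₊}`. [cite: Slade2017, §6.3] [cite: BrydgesSlade2015RGV, §3.1, §4.2 ((4.21)–(4.22)), §4.3 ((4.27)), §5.1 ((e:13)), §6.1 ((6.1))] -/
def sladeStepData (Cm : Matrix (TorusSite d M) (TorusSite d M) ℝ) (V : ℝ × ℝ × ℝ)
    (K : Finset (TorusSite d M) → (TorusSite d M → Fin n → ℝ) → ℝ) :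
    StepData ((TorusSite d M → Fin n → ℝ) → ℝ) d M :=
  let Vh := vHat (n := n) P V K
  let U := uPlus (n := n) P V K
  let δu := U.2.2
  let Vplus : ℝ × ℝ × ℝ := (U.1, U.2.1, 0)
  { I := iBlock P V
    Ihat := iBlock P Vh
    Itil := fun B => Ifun P.b P.pN P.dφ' P.dplus P.w' P.A U.1 U.2.1 U.2.2 B
    Iplus' := fun B => (fun _ => Real.exp (-δu)) ^ B.card * Ifun P.b' P.pN P.dφ' P.dplus P.w' P.A Vplus.1 Vplus.2.1 Vplus.2.2 B
    Iplus := fun B => Ifun P.b' P.pN P.dφ' P.dplus P.w' P.A Vplus.1 Vplus.2.1 Vplus.2.2 B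
    J := mapOneJ P.b P.pN P.dφ P.dplus (iBlock P V) K
    h := hldg (n := n) P Cm Vh
    c := fun _ => Real.exp (-δu)
    c' := fun _ => Real.exp δu }

/-- `e^{-δu₊} e^{δu₊} = 1`. [folklore] -/
theorem sladeStepData_c_mul_c' (Cm : Matrix (TorusSite d M) (TorusSite d M) ℝ) (V : ℝ × ℝ × ℝ)
    (K : Finset (TorusSite d M) → (TorusSite d M → Fin n → ℝ) → ℝ) :
    (sladeStepData (n := n) P Cm V K).c * (sladeStepData (n := n) P Cm V K).c' = 1 := by
  funext φ
  simp only [sladeStepData, Pi.mul_apply, Pi.one_apply, ← Real.exp_add, neg_add_cancel, Real.exp_zero]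

/-- `I_pt⁺(B) = e^{-δu₊|B|} I₊(B)` (by construction). [cite: BrydgesSlade2015RGV, §6.2 ((6.14): I_pt⁺(Z) = e^{v(Z)} I₊(Z) e^{-V_∂})] -/
theorem sladeStepData_Iplus' (Cm : Matrix (TorusSite d M) (TorusSite d M) ℝ) (V : ℝ × ℝ × ℝ)
    (K : Finset (TorusSite d M) → (TorusSite d M → Fin n → ℝ) → ℝ) (x : TorusSite d M) :
    (sladeStepData (n := n) P Cm V K).Iplus' (block P.b' x) =
      (sladeStepData (n := n) P Cm V K).c ^ (block P.b' x).card * (sladeStepData (n := n) P Cm V K).Iplus (block P.b' x) := rfl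

/-- **Slade's `K₊(V,K)`**: the composite `Map 6 ∘ ⋯ ∘ Map 1` of [BS-rg-step] §3.1 with Slade's step
data and the Gaussian fluctuation expectation `𝔼_{C_{j+1}}`. [cite: Slade2017, §6.3 ("K₊ : 𝔻 → 𝒦₊(Λ) … The maps are defined in [BS-rg-step]")] [cite: BrydgesSlade2015RGV, §3.1 ((3.1))] -/
def kPlusSlade (Cm : Matrix (TorusSite d M) (TorusSite d M) ℝ) (V : ℝ × ℝ × ℝ)
    (K : Finset (TorusSite d M) → (TorusSite d M → Fin n → ℝ) → ℝ) :
    Finset (TorusSite d M) → (TorusSite d M → Fin n → ℝ) → ℝ :=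
  kPlus P.b P.b' (iotaF d M n) (thetaF d M n) (expectF Cm n) (sladeStepData (n := n) P Cm V K) K

/-- **The representation identity for Slade's RG map** (§6.3: "`(V,K) ∈ 𝔻_j` determine
`U₊(V,K) = (δu₊, V₊)` and `K₊ = K₊(V,K)`, with `I = I(V)` and `I₊ = I₊(V₊)`, with the property that
`𝔼₊θ(I ∘ K)(Λ) = e^{-δu₊|Λ|}(I₊ ∘ K₊)(Λ)`"), for `𝔼₊ = 𝔼_{C}` with `C` positive semidefinite of
`ℓ^∞`-range `r`, `r + 2^{d+1}L^j ≤ L^{j+1} + 1`, `L^j ∣ L^{j+1} ∣ L^N`; hypotheses: regularity of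
the step data (`StepRegular`: locality/measurability of `I(V), I(V̂), J`, of `K ∈ 𝒦_j`, and
component factorisation of `K`) and integrability of the Map-3 terms in the fluctuation field.
[cite: Slade2017, §6.3 (defining property of the RG map)] [cite: BrydgesSlade2015RGV, §3.1 ((3.8) = (rgmapdef-bis))] -/
theorem expectF_theta_circ_eq_kPlusSlade (Cm : Matrix (TorusSite d M) (TorusSite d M) ℝ) (V : ℝ × ℝ × ℝ)
    (K : Finset (TorusSite d M) → (TorusSite d M → Fin n → ℝ) → ℝ)
    (hreg : StepRegular P.b (sladeStepData (n := n) P Cm V K) K) (hbb : P.b ∣ P.b') (hC : Cm.PosSemidef) {r : ℕ}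
    (hCr : ∀ x y, r ≤ tdist x y → Cm x y = 0) (hb : 0 < P.b) (hb' : 0 < P.b') (hbM : P.b' ∣ M) (hd : 0 < d)
    (hL : r + 2 * (2 ^ d * P.b) ≤ P.b' + 1)
    (hP : ∀ Y, IsPolymer P.b Y → SecIntegrable (fieldGaussian (TorusSite d M) Cm n)
      (circ P.b (blockProd P.b (deltaI (iotaF d M n) (thetaF d M n) (sladeStepData (n := n) P Cm V K).Ihat
        (sladeStepData (n := n) P Cm V K).Itil)) (fun X => thetaF d M n (kTwo P.b (sladeStepData (n := n) P Cm V K) K X)) Y)) :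
    expectF Cm n (thetaF d M n (circ P.b (blockProd P.b (iBlock P V)) K univ)) =
      (fun _ => Real.exp (-(uPlus (n := n) P V K).2.2)) ^ (univ : Finset (TorusSite d M)).card *
        circ P.b' (blockProd P.b' (sladeStepData (n := n) P Cm V K).Iplus) (kPlusSlade (n := n) P Cm V K) univ :=
  expectF_theta_circ_eq_kPlus P.b P.b' Cm hreg hbb hC hCr hb hb' hbM hd hL hP
    (fun U B h => hldg_support P Cm _ U B h) (sladeStepData_Iplus' P Cm V K) (sladeStepData_c_mul_c' P Cm V K)

end StepDef

end Polymer

end LongRangePhi4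

end Literature.Barriers.CriticalPhenomena
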